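import Summits.QuantumAdvantage.QuantumAdvantage.Theorems.InnerDegreeLawsE

set_option linter.dupNamespace false

/-!
# InnerDegreeLawsF (lens 4, g27; part F = LAND-PACKAGE-3 delta 2) — subset-pattern matrices in characteristic two (zeta involution, Lovász–Saks diagonalisation, exact rank) the MOD_p-rectangle kill (first dense-compatible one-register instance decided) and its AFFINE form for every non-constant table

Blocker `X = AbsorptionDial.NoPerfectPolyOdd` (item 28487); decomp-qadv lens 4 (minimal-counterexample / extremal reduction), g27.  The NODE record
(rung `QuadFormNoPerfectOdd`, residual `QuadLiftOdd`, sub-rung `OneQuadNoPerfectOdd`, floor `linFormFloor`, `x_iff_pieces`) lives in the cell file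
`g27/InnerDegreeDial.lean` and is NOT landed (Prop-definition node pieces); the tree parts are Prop-definition-free and state only unconditional LAWS.
Parts A–D (LAW C/Q/E/S/C⁺, first-moment subcubes, deletion identity, normal form) are LANDED (p825604/p825613/p825616/p825666);
parts E–F are the LAND-PACKAGE-3 deltas on top of them.  Kernel-checked content:

* §12 **the `MOD_p`-rectangle kill (`loss_of_modRectangle`)** — the first dense-compatible instance of (c0) decided: in characteristic two
  the intersection-pattern matrix `[g(S ∩ T)]_{S,T ⊆ [m]}` factors as `Zᵀ·diag(ĝ)·Z` through the involutive zeta matrix (`zeta_mul_zeta`,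
  `interMatrix_eq`, `rank_interMatrix`: rank `= #{ĝ ≠ 0}`), and `ĝ = 1` on sets of size `2^t` for `g = [p ∣ |·|]` (`hat_modInd_pow_two`);
  so a live `MOD_p`-rectangle of order `m` with `C(m, 2^t) > (n+1)·2p^k + 1` in one register's firing set (e.g. a planted balanced inner
  product inside an otherwise ARBITRARY dense quadratic, block size `≈ 4 log₂(n p^k)`, below the reach of LAW Q) kills perfection.

0 sorry · no instance / notation / native_decide · axioms standard.
* §13 **the AFFINE rectangle kill `loss_of_affineRectangle` (every non-constant table).**  Same, with `g₀` firing on the rectangle according to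
  `G₀(|S ∩ T|·a + e)` for ANY table `G₀ : ZMod p → Bool` separating `e` from `2^t·a + e` (`hat_affInd_pow_two`); `exists_shift_ne` (translation by
  `ρ ≠ 0` is a `p`-cycle) supplies the separating offset for every non-constant `G₀`, `a ≠ 0` — so the planted register may read `Q` through an
  arbitrary non-constant table, and the monomial case of «PatternRank» is kernel for all tables and offsets.
-/

open Finset
open Summit.QuantumAdvantage.AdviceFreeQNC0

namespace Summit.QuantumAdvantage.QuantumAdvantage.Theorems.InnerDegreeDial

/-! ### §12 the subset-pattern matrices in characteristic two and the `MOD_p`-RECTANGLE KILL (first dense-compatible instance of (c0)) -/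

section RectangleKill

variable {K : Type*} [Field K] {m : ℕ}

/-- the subset (zeta) matrix of the Boolean lattice of `Fin m` -/
def zeta (K : Type*) [Zero K] [One K] (m : ℕ) : Matrix (Finset (Fin m)) (Finset (Fin m)) K :=
  Matrix.of fun R T => if R ⊆ T then 1 else 0

/-- in characteristic two the zeta matrix is an involution (`#[R, T] = 2^{|T∖R|}`) -/
theorem zeta_mul_zeta [CharP K 2] : zeta K m * zeta K m = 1 := by
  ext R T
  rw [Matrix.mul_apply]
  have hterm : ∀ W, zeta K m R W * zeta K m W T = if W ∈ Finset.Icc R T then (1 : K) else 0 := by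
    intro W
    unfold zeta
    simp only [Matrix.of_apply, Finset.mem_Icc]
    by_cases h1 : R ⊆ W <;> by_cases h2 : W ⊆ T <;> simp [h1, h2]
  simp_rw [hterm]
  rw [sum_boole, Finset.filter_mem_eq_inter, Finset.univ_inter, Matrix.one_apply]
  by_cases hRT : R ⊆ T
  · rw [Finset.card_Icc_finset hRT]
    by_cases h : R = T
    · subst h
      simp
    · have hlt : R.card < T.card := Finset.card_lt_card (lt_of_le_of_ne hRT h)
      obtain ⟨j, hj⟩ : ∃ j, T.card - R.card = j + 1 := ⟨T.card - R.card - 1, by omega⟩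
      rw [if_neg h, hj]
      exact (CharP.cast_eq_zero_iff K 2 _).mpr ⟨2 ^ j, by rw [pow_succ, mul_comm]⟩
  · rw [Finset.Icc_eq_empty (by exact hRT), Finset.card_empty, Nat.cast_zero, if_neg]
    rintro rfl
    exact hRT (subset_refl _)

/-- the subset-sum transform (Möbius = zeta in characteristic two) -/
def hat (g : Finset (Fin m) → K) (R : Finset (Fin m)) : K := ∑ R', if R' ⊆ R then g R' else 0

/-- inversion: summing the transform over the subsets of `W` returns `g W` (char two) -/
theorem sum_hat [CharP K 2] (g : Finset (Fin m) → K) (W : Finset (Fin m)) :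
    (∑ R, if R ⊆ W then hat g R else 0) = g W := by
  have hre : ∀ R, (if R ⊆ W then hat g R else 0) = ∑ R', g R' * (zeta K m R' R * zeta K m R W) := by
    intro R
    unfold hat zeta
    simp only [Matrix.of_apply]
    by_cases h : R ⊆ W
    · rw [if_pos h]
      refine sum_congr rfl fun R' _ => ?_
      by_cases h' : R' ⊆ R <;> simp [h, h']
    · rw [if_neg h]
      symm
      refine sum_eq_zero fun R' _ => ?_
      simp [h]
  rw [sum_congr rfl fun R _ => hre R, Finset.sum_comm]
  simp_rw [← Finset.mul_sum, ← Matrix.mul_apply, zeta_mul_zeta, Matrix.one_apply, mul_ite, mul_one, mul_zero]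
  simp

/-- the INTERSECTION-PATTERN matrix `[g (S ∩ T)]` of a set function -/
def interMatrix (g : Finset (Fin m) → K) : Matrix (Finset (Fin m)) (Finset (Fin m)) K := Matrix.of fun S T => g (S ∩ T)

/-- factorisation `[g(S ∩ T)] = Zᵀ · diag(ĝ) · Z` through the zeta matrix -/
theorem interMatrix_eq [CharP K 2] (g : Finset (Fin m) → K) :
    interMatrix g = Matrix.transpose (zeta K m) * (Matrix.diagonal (hat g) * zeta K m) := by
  classical
  ext S T
  rw [interMatrix, Matrix.of_apply, Matrix.mul_apply, ← sum_hat g (S ∩ T)]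
  refine sum_congr rfl fun R _ => ?_
  rw [Matrix.transpose_apply, Matrix.diagonal_mul]
  unfold zeta
  simp only [Matrix.of_apply, Finset.subset_inter_iff]
  by_cases h1 : R ⊆ S <;> by_cases h2 : R ⊆ T <;> simp [h1, h2]

/-- **rank of an intersection-pattern matrix** in characteristic two = the number of sets on which the subset-sum transform is non-zero -/
theorem rank_interMatrix [CharP K 2] [DecidableEq K] (g : Finset (Fin m) → K) :
    (interMatrix g).rank = Fintype.card {R : Finset (Fin m) // hat g R ≠ 0} := by
  classical
  have hz : IsUnit (zeta K m).det := Matrix.isUnit_det_of_left_inverse zeta_mul_zeta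
  rw [interMatrix_eq, Matrix.rank_mul_eq_right_of_isUnit_det _ _ (Matrix.isUnit_det_transpose _ hz),
    Matrix.rank_mul_eq_left_of_isUnit_det _ _ hz, Matrix.rank_diagonal]

/-- the `MOD_p` set function: `[p ∣ |W|]` -/
def modInd (K : Type*) [Zero K] [One K] (p : ℕ) (W : Finset (Fin m)) : K := if p ∣ W.card then 1 else 0

/-- the subset-sum transform of `[p ∣ |·|]` is `1` (hence non-zero) on every set of size a power of two, for `p` an odd prime:
`Σ_{p ∣ j} C(2^t, j) ≡ 1 (mod 2)` since `C(2^t, j)` is even for `0 < j < 2^t` and `p ∤ 2^t`. -/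
theorem hat_modInd_pow_two [CharP K 2] {p : ℕ} (hp : p.Prime) (hp2 : p ≠ 2) (t : ℕ) (R : Finset (Fin m)) (hR : R.card = 2 ^ t) :
    hat (modInd K p) R = 1 := by
  classical
  unfold hat modInd
  rw [show (∑ R' : Finset (Fin m), if R' ⊆ R then (if p ∣ R'.card then (1 : K) else 0) else 0)
      = ∑ R' ∈ R.powerset, (fun j : ℕ => if p ∣ j then (1 : K) else 0) R'.card by
    rw [← Finset.sum_filter, Finset.filter_subset_univ]]
  have key := Finset.sum_powerset_apply_card (fun j : ℕ => if p ∣ j then (1 : K) else 0) (x := R)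
  rw [key]
  obtain ⟨q, hq⟩ : ∃ q, 2 ^ t = q + 1 := ⟨2 ^ t - 1, by have := Nat.one_le_two_pow (n := t); omega⟩
  have htop : ¬ p ∣ q + 1 := fun h =>
    hp2 ((Nat.prime_dvd_prime_iff_eq hp Nat.prime_two).mp (hp.dvd_of_dvd_pow (hq ▸ h : p ∣ 2 ^ t)))
  have hmid : ∀ j ∈ Finset.range q, (q + 1).choose (j + 1) • (if p ∣ (j + 1) then (1 : K) else 0) = 0 := by
    intro j hj
    have hjq : j < q := Finset.mem_range.mp hj
    have h2 : 2 ∣ (q + 1).choose (j + 1) := by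
      rw [← hq]
      exact (Nat.prime_two.dvd_choose_pow_iff).mpr ⟨Nat.succ_ne_zero j, by omega⟩
    obtain ⟨r, hr⟩ := h2
    rw [nsmul_eq_mul, hr, Nat.cast_mul, Nat.cast_two, CharTwo.two_eq_zero, zero_mul, zero_mul]
  rw [hq] at hR
  rw [hR, Finset.sum_range_succ, Nat.choose_self, one_smul, if_neg htop, add_zero,
    Finset.sum_range_succ', Nat.choose_zero_right, one_smul, if_pos (dvd_zero p), Finset.sum_eq_zero hmid, zero_add]

variable {p : ℕ} [Fact p.Prime] {n : ℕ}

/-- **THE `MOD_p`-RECTANGLE KILL (first dense-compatible instance of the face (c0), by LAW R).**  Registers `k`-form except `g₀`.  Suppose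
`g₀`'s firing set contains a LIVE `MOD_p`-RECTANGLE of order `m`: input families `X S`, `Y T` (`S, T ⊆ [m]`, disjoint supports) on which
`g₀` is live and fires exactly when `p ∣ |S ∩ T|`.  Then the strategy is not perfect as soon as `C(m, 2^t) > (n+1)·2p^k + 1` for some `t`
— so `m ≈ log₂((n+1)·2p^k) + O(log log)` suffices.  REALISATION (planted inner product): `g₀ = [Q ≡ 0 (p)]` where `Q` restricted to a block
`B` of `4m + 2` coordinates right of the cut `g₀` is `Σ_{i<m} u_{i⁺} u_{i'⁺}` (balanced encoding `S ↦ (1_S, 1_{Sᶜ})` on the `x`-pairs,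
`T ↦ (1_T, 1_{Tᶜ})` on the `y`-pairs, `≤ 2` always-on pad coordinates fixing the walk exponent `2m + π` to a live residue) and `Q` ARBITRARY
(dense, generic) outside `B`: then `Q(X S ∪ Y T) = |S ∩ T|` and the rectangle is live.  Such `Q` have an independent set of size only
`3m + 2 ≈ 3 log₂(n p^k)`, BELOW the reach `m₀ ≈ 2p·ln(2(n+1)p^{k+1})` of LAW Q / LAW C⁺, and are not shared (LAW S) nor few-form (LAW C): the
first kill of a dense-quadratic one-register strategy in the tree's cone (NODE-g27 §3 (c0)). -/
theorem loss_of_modRectangle (hp5 : 5 ≤ p) {k m t : ℕ} (c : ℕ)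
    (y : Fin (n + 1) → (Fin n → Bool) → Bool) (g₀ : Fin (n + 1))
    (lam : Fin (n + 1) → Fin k → Fin n → ZMod p) (F : Fin (n + 1) → (Fin k → ZMod p) → Bool)
    (hF : ∀ g, g ≠ g₀ → ∀ u, y g u = F g (fun j => ∑ i, if u i = true then lam g j i else 0))
    (X Y : Finset (Fin m) → Fin n → Bool) (hd : ∀ S T l, ¬ (X S l = true ∧ Y T l = true))
    (hpat : ∀ S T, y g₀ (bor (X S) (Y T)) = decide (p ∣ (S ∩ T).card))
    (hlive : ∀ S T, liveCut c (bor (X S) (Y T)) g₀ = true)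
    (ht : (n + 1) * (p ^ k * 2) + 1 < m.choose (2 ^ t)) :
    ∃ u, ringWinU c y u = false := by
  classical
  obtain ⟨hK, -, -, -, -⟩ := Coset21.exists_charTwo_roots p hp5
  haveI := hK
  have hp : p.Prime := Fact.out
  have hp2 : p ≠ 2 := by omega
  refine loss_of_rectRank hp5 c y g₀ lam F hF X Y hd (lt_of_lt_of_le ht ?_)
  have hrect : rect (Kp p) (fun u => y g₀ u && liveCut c u g₀) X Y = interMatrix (modInd (Kp p) p) := by
    ext S T
    rw [rect, Matrix.of_apply, interMatrix, Matrix.of_apply, modInd]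
    simp only [hpat S T, hlive S T, Bool.and_true, decide_eq_true_eq]
  have hc : Fintype.card {R : Finset (Fin m) // R.card = 2 ^ t} = m.choose (2 ^ t) := by
    rw [Fintype.card_finset_len, Fintype.card_fin]
  rw [hrect, rank_interMatrix, ← hc]
  refine Fintype.card_le_of_injective
    (fun R => ⟨R.1, by rw [hat_modInd_pow_two hp hp2 t R.1 R.2]; exact one_ne_zero⟩) ?_
  intro R R' h
  have h' := congrArg Subtype.val h
  exact Subtype.ext h'

end RectangleKill

/-! ### §13 the AFFINE rectangle kill: EVERY non-constant table `G₀ : ZMod p → Bool` and every offset (live affine `MOD_p`-rectangles of a one-dense-register strategy kill) -/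

section AffineKill

variable {K : Type*} [Field K] {m : ℕ} {p : ℕ}

/-- the affine-pattern set function `W ↦ [G₀(|W|·a + e)]` of a table `G₀ : ZMod p → Bool` -/
def affInd (K : Type*) [Zero K] [One K] (G₀ : ZMod p → Bool) (a e : ZMod p) (W : Finset (Fin m)) : K :=
  if G₀ ((W.card : ZMod p) * a + e) = true then 1 else 0

/-- the subset-sum transform of an affine pattern is `1` on every set of size `2^t` as soon as the table SEPARATES `e` from `2^t·a + e`:
`Σ_j C(2^t, j)·[G₀(j a + e)] ≡ [G₀(e)] + [G₀(2^t a + e)] (mod 2)` (`C(2^t, j)` even for `0 < j < 2^t`; no Lucas needed). -/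
theorem hat_affInd_pow_two [CharP K 2] (G₀ : ZMod p → Bool) (a e : ZMod p) (t : ℕ)
    (hG : G₀ (((2 ^ t : ℕ) : ZMod p) * a + e) ≠ G₀ e) (R : Finset (Fin m)) (hR : R.card = 2 ^ t) :
    hat (affInd K G₀ a e) R = 1 := by
  classical
  unfold hat affInd
  rw [show (∑ R' : Finset (Fin m), if R' ⊆ R then (if G₀ ((R'.card : ZMod p) * a + e) = true then (1 : K) else 0) else 0)
      = ∑ R' ∈ R.powerset, (fun j : ℕ => if G₀ ((j : ZMod p) * a + e) = true then (1 : K) else 0) R'.card by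
    rw [← Finset.sum_filter, Finset.filter_subset_univ]]
  have key := Finset.sum_powerset_apply_card (fun j : ℕ => if G₀ ((j : ZMod p) * a + e) = true then (1 : K) else 0) (x := R)
  rw [key]
  obtain ⟨q, hq⟩ : ∃ q, 2 ^ t = q + 1 := ⟨2 ^ t - 1, by have := Nat.one_le_two_pow (n := t); omega⟩
  have hmid : ∀ j ∈ Finset.range q,
      (q + 1).choose (j + 1) • (if G₀ (((j + 1 : ℕ) : ZMod p) * a + e) = true then (1 : K) else 0) = 0 := by
    intro j hj
    have hjq : j < q := Finset.mem_range.mp hj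
    have h2 : 2 ∣ (q + 1).choose (j + 1) := by
      rw [← hq]
      exact (Nat.prime_two.dvd_choose_pow_iff).mpr ⟨Nat.succ_ne_zero j, by omega⟩
    obtain ⟨r, hr⟩ := h2
    rw [nsmul_eq_mul, hr, Nat.cast_mul, Nat.cast_two, CharTwo.two_eq_zero, zero_mul, zero_mul]
  rw [hq] at hR hG
  rw [hR, Finset.sum_range_succ, Nat.choose_self, one_smul, Finset.sum_range_succ', Nat.choose_zero_right, one_smul,
    Finset.sum_eq_zero hmid, zero_add, Nat.cast_zero, zero_mul, zero_add]
  generalize hz : ((q + 1 : ℕ) : ZMod p) = z at hG ⊢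
  cases h0 : G₀ e <;> cases h1 : G₀ (z * a + e) <;> simp_all

/-- a NON-CONSTANT table on `ZMod p` separates some residue from its translate by any non-zero `ρ` (translation by `ρ ≠ 0` is a `p`-cycle):
used to SHIFT the offset of an affine rectangle into the separating position (force `e′` common base elements, `e′·a ≡ e₀ − e`). -/
theorem exists_shift_ne [Fact p.Prime] (G₀ : ZMod p → Bool) {b₁ b₂ : ZMod p} (hb : G₀ b₁ ≠ G₀ b₂) {ρ : ZMod p} (hρ : ρ ≠ 0) :
    ∃ e, G₀ (ρ + e) ≠ G₀ e := by
  by_contra h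
  have h' : ∀ e, G₀ (ρ + e) = G₀ e := fun e => Classical.byContradiction fun hne => h ⟨e, hne⟩
  have hk : ∀ (j : ℕ) (e : ZMod p), G₀ ((j : ZMod p) * ρ + e) = G₀ e := by
    intro j
    induction j with
    | zero => intro e; rw [Nat.cast_zero, zero_mul, zero_add]
    | succ j ih => intro e; rw [Nat.cast_succ, add_mul, one_mul, add_assoc, ih]; exact h' e
  have hval : ((((b₂ - b₁) * ρ⁻¹).val : ℕ) : ZMod p) = (b₂ - b₁) * ρ⁻¹ := ZMod.natCast_zmod_val _
  have h12 := hk (((b₂ - b₁) * ρ⁻¹).val) b₁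
  rw [hval, mul_assoc, inv_mul_cancel₀ hρ, mul_one, sub_add_cancel] at h12
  exact hb h12.symm

variable [Fact p.Prime] {n : ℕ}

/-- **THE AFFINE RECTANGLE KILL (every non-constant table, by LAW R).**  Registers `k`-form except `g₀`; `g₀` is LIVE on a rectangle of input
families `X S`, `Y T` (`S, T ⊆ [m]`, disjoint supports) and fires there according to an AFFINE `MOD_p` PATTERN `G₀(|S ∩ T|·a + e)` read through
ANY table `G₀ : ZMod p → Bool` that separates `e` from `2^t·a + e`.  Then the strategy is not perfect once `C(m, 2^t) > (n+1)·2p^k + 1`.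
With `exists_shift_ne` (shift the offset by forcing `e′ < p` common base elements) this covers EVERY non-constant `G₀` and every `a ≠ 0`:
so in the planted realisation of `loss_of_modRectangle` the register may read the planted quadratic form through an ARBITRARY non-constant
table (`y g₀ = G₀ ∘ Q`), and in the (c0) programme (NODE-g27 §3 (c0)(iv)) the whole MONOMIAL case of «PatternRank» — cross block `⊇` a diagonal
block with a constant non-zero coefficient `a`, any table, any offset — is kernel: `rank ≥ C(m − p + 1, 2^t)`. -/
theorem loss_of_affineRectangle (hp5 : 5 ≤ p) {k m t : ℕ} (c : ℕ)
    (y : Fin (n + 1) → (Fin n → Bool) → Bool) (g₀ : Fin (n + 1))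
    (lam : Fin (n + 1) → Fin k → Fin n → ZMod p) (F : Fin (n + 1) → (Fin k → ZMod p) → Bool)
    (hF : ∀ g, g ≠ g₀ → ∀ u, y g u = F g (fun j => ∑ i, if u i = true then lam g j i else 0))
    (X Y : Finset (Fin m) → Fin n → Bool) (hd : ∀ S T l, ¬ (X S l = true ∧ Y T l = true))
    (G₀ : ZMod p → Bool) (a e : ZMod p)
    (hpat : ∀ S T, y g₀ (bor (X S) (Y T)) = G₀ (((S ∩ T).card : ZMod p) * a + e))
    (hG : G₀ (((2 ^ t : ℕ) : ZMod p) * a + e) ≠ G₀ e)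
    (hlive : ∀ S T, liveCut c (bor (X S) (Y T)) g₀ = true)
    (ht : (n + 1) * (p ^ k * 2) + 1 < m.choose (2 ^ t)) :
    ∃ u, ringWinU c y u = false := by
  classical
  obtain ⟨hK, -, -, -, -⟩ := Coset21.exists_charTwo_roots p hp5
  haveI := hK
  refine loss_of_rectRank hp5 c y g₀ lam F hF X Y hd (lt_of_lt_of_le ht ?_)
  have hrect : rect (Kp p) (fun u => y g₀ u && liveCut c u g₀) X Y = interMatrix (affInd (Kp p) G₀ a e) := by
    ext S T
    rw [rect, Matrix.of_apply, interMatrix, Matrix.of_apply, affInd]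
    simp only [hpat S T, hlive S T, Bool.and_true]
  have hc : Fintype.card {R : Finset (Fin m) // R.card = 2 ^ t} = m.choose (2 ^ t) := by
    rw [Fintype.card_finset_len, Fintype.card_fin]
  rw [hrect, rank_interMatrix, ← hc]
  refine Fintype.card_le_of_injective
    (fun R => ⟨R.1, by rw [hat_affInd_pow_two G₀ a e t hG R.1 R.2]; exact one_ne_zero⟩) ?_
  intro R R' h
  have h' := congrArg Subtype.val h
  exact Subtype.ext h'

end AffineKill

end Summit.QuantumAdvantage.QuantumAdvantage.Theorems.InnerDegreeDial
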